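import Literature.IUT.HodgeArakelov.MonoThetaCyclotomes
import Mathlib.CategoryTheory.Equivalence
import Mathlib.CategoryTheory.Endomorphism

/-!
# [IUTchII] §1, Propositions 1.2–1.4: mono-theta environments from groups and from Frobenioids

Mochizuki, *Inter-universal Teichmüller theory II*, §1, Proposition 1.2 (i), (ii) (pp. 25–26),
Proposition 1.3 (i)–(iii) (pp. 26–27), Proposition 1.4 (p. 27) [claim: Mochizuki2012, status: disputed] (IUTchII §1 Props 1.2-1.4, kurims pp.25-27).
Record-only typing under the claim key `Mochizuki2012` (D-0012, disputed): definitions and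
`Prop`-valued statements only; the printed proofs are one-line references to [EtTh], [AbsTopIII]
("follow immediately from the results … quoted in the statements").

* Prop. 1.2 (i): `Π ↦ M^Θ(Π)` from a topological group `Π ≅ Π^tp_{X̲̲_k}`, with a functorial
  isomorphism `Π ≅ Π_X(M^Θ(Π))` and isomorphism indeterminacy of order `1` (`N` odd) / `2` (`N` even)
  — `EnvOfGroup`, `Prop12_i_indeterminacy`;
* Prop. 1.2 (ii): `𝒞 ↦ M^Θ(𝒞)` from a tempered Frobenioid, with `𝒟 ≅ B^temp(Π_X(M^Θ(𝒞)))⁰` —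
  `TemperedFrobenioidData` (INTERFACE: TODO-merge:abc-iut-L2-t3 [EtTh] §5, abc-iut-L3-t1 `B^temp(Π)⁰`,
  abc-iut-L1 Frobenioid structure), `EnvOfFrobenioid` (OUTPUT; no existence fact);
* Prop. 1.3 (i)–(iii): the Frobenioid-theoretic cyclotomes `(l·Δ_Θ)_S ⊗ ℤ/Nℤ ⊆ Aut(S^bs)` (subquotient),
  `μ_N(S) ⊆ O^×(S) ⊆ Aut(S)`, the isomorphisms `(*mono-Θ)` and `(*bs-Gal)` (the latter an INTERFACE to
  [AbsTopIII] Cor. 1.10 (c), Rmk. 3.2.1 — TODO-merge:abc-iut-L4-t1/t2), and the COINCIDENCE claim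
  `Prop13_iii` (named fact);
* Prop. 1.4: `Π ↦ Π_Ÿ(Π), (l·Δ_Θ)(Π), θ(Π) ⊆ H¹(Π_Ÿ(Π),(l·Δ_Θ)(Π))`, and the DEFINITION of
  `∞θ(Π) ⊆ lim_J H¹(Π_Ÿ(Π)|_J,(l·Δ_Θ)(Π))` ("some positive multiple coincides, up to torsion, with an
  element of `θ(Π)`") over an INTERFACE cohomology system (`CohomologySystem`; continuous group
  cohomology of tempered groups is not in the tree — TODO-merge:abc-iut-L2-t1 [EtTh] §1).

Encoding conventions and the underline caveat as in `MonoThetaCyclotomes`.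
-/

namespace Literature.IUT.HodgeArakelov

universe u

open CategoryTheory

variable {S : ThetaSetting.{u}}

/-! ## Proposition 1.2 (i): from topological groups to mono-theta environments -/

/-- **IUTchII:Prop1.2(i)** (p. 25), OUTPUT of `Π ↦ M^Θ(Π)` for "`Π` a topological group isomorphic to
`Π^tp_{X̲̲_k}`": "a mod `N` mono-theta environment up to isomorphism [cf. [EtTh], Corollary 2.18, (ii)]
such that the composite of this algorithm with the algorithm `M^Θ(Π) ↦ Π_X(M^Θ(Π))` discussed in
Definition 1.1, (i), admits a functorial isomorphism `Π ≅ Π_X(M^Θ(Π))`."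
[claim: Mochizuki2012, status: disputed] (IUTchII §1 Prop 1.2 (i), kurims p.25) -/
structure EnvOfGroup (S : ThetaSetting.{u}) (P : TopGroup.{u}) : Type (u + 1) where
  /-- the witness "`Π` isomorphic to `Π^tp_{X̲̲_k}`" (input hypothesis) -/
  isoRef : Nonempty (P ≃ₜ* S.PiX)
  /-- `M^Θ(Π)` -/
  env : MonoThetaEnv S
  /-- the Def. 1.1 (i) output for `M^Θ(Π)` -/
  recon : Reconstruction env
  /-- the functorial isomorphism `Π ≅ Π_X(M^Θ(Π))` -/
  isoX : P ≃ₜ* recon.PiX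

/-! **Existence clause** of Prop. 1.2 (i) ("there exists a functorial group-theoretic algorithm …"): NOT typed as a named
fact (reviews of `MonoThetaCyclotomes`: over an axiom-free interface the transport form is trivially provable and
the unguarded form is false for junk settings). The existence content is the owners' construction of the output
below for the genuine reference group ([EtTh] Cor. 2.18 (ii), abc-iut-L2-t2); functoriality = transport of the output structure along `≃ₜ*`. -/

/-- Two automorphisms of a mono-theta environment are **`μ_N`-conjugate** (relative to a Def. 1.1 (i)
output `R`) if they differ by the inner automorphism of an element of `Π_μ(M) = Ker(Π_M ↠ Π_Y(M))`
([EtTh] Cor. 2.18 (iv): "`Isom^μ` … the set of `μ_N`-conjugacy classes of isomorphisms").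
[claim: Mochizuki2012, status: disputed] (IUTchII §1 Prop 1.2 (i), kurims p.25) -/
def MuConjugate {M : MonoThetaEnv S} (R : Reconstruction M) (α β : MonoThetaEnv.Iso M M) : Prop :=
  ∃ m : R.extCyc, ∀ x : M.Pi, β.iso x = (m : M.Pi) * α.iso x * (m : M.Pi)⁻¹

/-- **IUTchII:Prop1.2(i)** (p. 25): "the isomorphism indeterminacy of `M^Θ(Π)` is with
respect to a group of `μ_N`-conjugacy classes of automorphisms which is of order `1` (respectively, `2`)
if `N` is odd (respectively, even) [cf. [EtTh], Corollary 2.18, (iv)]." Typed ([EtTh] Cor. 2.18 (iv):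
the map `Isom^μ(M, M) → Isom(Π_X, Π_X)` has fibres of cardinality `1`/`2`): the automorphisms of `M`
acting trivially on `Π_Y(M)` (hence on `Π_X(M)`) form exactly `1` (resp. `2`) `μ_N`-conjugacy classes.
PREDICATE on `(M, R)` (asserted by the text for genuine mono-theta environments).
[claim: Mochizuki2012, status: disputed] (IUTchII §1 Prop 1.2 (i), kurims p.25) -/
def Prop12_i_indeterminacy {M : MonoThetaEnv S} (R : Reconstruction M) : Prop :=
    ∃ T : Finset (MonoThetaEnv.Iso M M),
      T.card = (if Odd (S.N : ℕ) then 1 else 2) ∧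
      (∀ α ∈ T, ∀ x : M.Pi, R.projY (α.iso x) = R.projY x) ∧
      ∀ α : MonoThetaEnv.Iso M M, (∀ x : M.Pi, R.projY (α.iso x) = R.projY x) →
        ∃! τ, τ ∈ T ∧ MuConjugate R τ α

/-! ## Proposition 1.2 (ii): from tempered Frobenioids (INTERFACE) -/

/-- INTERFACE for **Prop. 1.2 (ii)** (pp. 25–26): "`𝒞` a category equivalent to the tempered Frobenioid
determined by `X̲̲_k` [i.e., the Frobenioid denoted `𝒞` at the beginning of [EtTh], §5; `ℱ̲_v` in
[IUTchI], Example 3.2, (i)]. Thus, `𝒞` admits a natural Frobenioid structure over a base category `𝒟`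
equivalent to `B^temp(Π^tp_{X̲̲_k})⁰` [cf. [FrdI], Corollary 4.11, (ii), (iv); [EtTh], Proposition 5.1]."
Carried: the categories `𝒞`, `𝒟`, the base functor, the assignment `Π ↦ B^temp(Π)⁰` (connected
temperoids, [SemiAnbd]/[IUTchI] §0) as an abstract category-valued function on topological groups, the
equivalence `𝒟 ≌ B^temp(Π^tp_{X̲̲_k})⁰`; that `𝒞` IS (equivalent to) the tempered Frobenioid of `X̲̲_k`
([EtTh] §5) is the content the interface owner supplies when this structure is merged. TODO-merge:abc-iut-L2-t3 ([EtTh] Def. 3.6, §5), abc-iut-L3-t1 (`B^temp(Π)⁰`), abc-iut-L1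
(Frobenioid structure). [claim: Mochizuki2012, status: disputed] (IUTchII §1 Prop 1.2 (ii), kurims p.25) -/
structure TemperedFrobenioidData (S : ThetaSetting.{u}) : Type (u + 2) where
  /-- the category `𝒞` -/
  C : Type (u + 1)
  [catC : Category.{u} C]
  /-- the base category `𝒟` -/
  D : Type (u + 1)
  [catD : Category.{u} D]
  /-- the Frobenioid structure morphism `𝒞 → 𝒟` -/
  base : C ⥤ D
  /-- `Π ↦ B^temp(Π)⁰` (interface) -/
  Btemp0 : TopGroup.{u} → Type (u + 1)
  [catB : ∀ G, Category.{u} (Btemp0 G)]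
  /-- transport of `B^temp(-)⁰` along isomorphisms of topological groups (interface functoriality) -/
  Btemp0_map : ∀ {G H : TopGroup.{u}}, (G ≃ₜ* H) → (Btemp0 G ≌ Btemp0 H)
  /-- "`𝒟` equivalent to `B^temp(Π^tp_{X̲̲_k})⁰`" -/
  baseEquiv : D ≌ Btemp0 S.PiX

attribute [instance] TemperedFrobenioidData.catC TemperedFrobenioidData.catD
  TemperedFrobenioidData.catB

/-- **IUTchII:Prop1.2(ii)** (pp. 25–26), OUTPUT of `𝒞 ↦ M^Θ(𝒞)`: "a mod `N` mono-theta environment [cf.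
[EtTh], Theorem 5.10, (iii)] such that the composite of this algorithm with the algorithm
`M^Θ(𝒞) ↦ Π_X(M^Θ(𝒞))` discussed in Definition 1.1, (i), admits a functorial isomorphism
`𝒟 ≅ B^temp(Π_X(M^Θ(𝒞)))⁰`." [claim: Mochizuki2012, status: disputed] (IUTchII §1 Prop 1.2 (ii), kurims pp.25-26) -/
structure EnvOfFrobenioid (F : TemperedFrobenioidData S) : Type (u + 1) where
  /-- `M^Θ(𝒞)` -/
  env : MonoThetaEnv S
  /-- its Def. 1.1 (i) output -/
  recon : Reconstruction env
  /-- the functorial equivalence `𝒟 ≅ B^temp(Π_X(M^Θ(𝒞)))⁰` -/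
  baseEquiv : F.D ≌ F.Btemp0 recon.PiX

/-! **Existence clause** of Prop. 1.2 (ii) ("there exists a functorial algorithm `𝒞 ↦ M^Θ(𝒞)` …", [EtTh]
Thm. 5.10 (iii)): NOT typed as a named fact (review of p405599: over this interface `Nonempty (EnvOfFrobenioid F)`
has no content about `𝒞`); `EnvOfFrobenioid` is the OUTPUT structure, the construction is the owners'
([EtTh] §5, abc-iut-L2-t4 `ThetaFrobenioid`, p404035). -/

/-! ## Proposition 1.3: compatibility of cyclotomic rigidity isomorphisms -/

/-- **IUTchII:Prop1.3(i)** (p. 26) "(Mono-theta Environments Associated to Tempered Frobenioids)": "For a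
suitable object `S ∈ Ob(𝒞)` [cf. [EtTh], Lemma 5.9, (v)], whose image in `𝒟` we denote by
`S^bs ∈ Ob(𝒟)`, the interior cyclotome `(l·Δ_Θ)(M^Θ(𝒞)) ⊗ (ℤ/Nℤ)` corresponds to a certain subquotient
of `Aut(S^bs)`, which we denote by `(l·Δ_Θ)_S ⊗ (ℤ/Nℤ)`, while the exterior cyclotome `Π_μ(M^Θ(𝒞))`
corresponds to the subgroup `μ_N(S) ⊆ O^×(S) ⊆ Aut(S)`. In particular, the cyclotomic rigidity
isomorphism of Definition 1.1, (ii), takes the form of an isomorphism `(l·Δ_Θ)_S ⊗ (ℤ/Nℤ) ≅ μ_N(S)`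
`(*mono-Θ)`." DATA over an output `E` of Prop. 1.2 (ii) and a Def. 1.1 (ii) isomorphism.
[claim: Mochizuki2012, status: disputed] (IUTchII §1 Prop 1.3 (i), kurims p.26) -/
structure FrobenioidCyclotomes {F : TemperedFrobenioidData S} (E : EnvOfFrobenioid F) : Type (u + 1)
    where
  /-- the "suitable object" `S ∈ Ob(𝒞)` ([EtTh] Lemma 5.9 (v)) -/
  obj : F.C
  /-- `(l·Δ_Θ)_S ⊗ (ℤ/Nℤ)`, a subquotient of `Aut(S^bs)`, `S^bs :=` the image of `S` in `𝒟` -/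
  intS : Subquotient (Aut (F.base.obj obj))
  /-- `μ_N(S) ⊆ O^×(S) ⊆ Aut(S)` -/
  muN : Subgroup (Aut obj)
  unitsS : Subgroup (Aut obj)
  muN_le : muN ≤ unitsS
  /-- "the interior cyclotome `(l·Δ_Θ)(M^Θ(𝒞)) ⊗ ℤ/Nℤ` corresponds to `(l·Δ_Θ)_S ⊗ ℤ/Nℤ`" -/
  corrInt : ModPow E.recon.intCyc.carrier (S.N : ℕ) ≃* intS.carrier
  /-- "the exterior cyclotome `Π_μ(M^Θ(𝒞))` corresponds to `μ_N(S)`" -/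
  corrExt : E.recon.extCyc ≃* muN

/-- **IUTchII:Prop1.3(i)**, the isomorphism `(*mono-Θ) : (l·Δ_Θ)_S ⊗ (ℤ/Nℤ) ≅ μ_N(S)` — "the cyclotomic
rigidity isomorphism of Definition 1.1, (ii)" transported along the correspondences (DEFINED).
[claim: Mochizuki2012, status: disputed] (IUTchII §1 Prop 1.3 (i), kurims p.26) -/
def FrobenioidCyclotomes.monoTheta {F : TemperedFrobenioidData S} {E : EnvOfFrobenioid F}
    (Z : FrobenioidCyclotomes E) (C : CyclotomicRigidity E.recon) : Z.intS.carrier ≃* Z.muN :=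
  Z.corrInt.symm.trans (C.iso.trans Z.corrExt)

/-- **IUTchII:Prop1.3(ii)** (p. 26) "(MLF-Galois Pairs)" — INTERFACE to [AbsTopIII]: "Relative to the formal
correspondence between `p`-adic Frobenioids [such as the base-field-theoretic hull `𝒞^{bs-fld}`
associated to `𝒞` — cf. [EtTh], Definition 3.6, (iv)] and MLF-Galois TM-pairs in the theory of
[AbsTopIII] [cf. [AbsTopIII], Remark 3.1.1], `μ_N(S)` corresponds to `μ_Ẑ(M_TM) ⊗ (ℤ/Nℤ)` [cf.
[AbsTopIII], Definition 3.1, (v)], while `(l·Δ_Θ)_S ⊗ (ℤ/Nℤ)` corresponds to `μ_Ẑ(Π_X) ⊗ (ℤ/Nℤ)` [cf.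
[AbsTopIII], Theorem 1.9, (b); Remark 1.10.1, (ii); [IUTchI], Remark 3.1.2, (iii)]. In particular, by
composing the inverse of the natural isomorphism `μ_Ẑ(G_k) ≅ μ_Ẑ(Π_X)` of [AbsTopIII], Corollary 1.10,
(c), with the inverse of the natural isomorphism `μ_Ẑ(M_TM) ≅ μ_Ẑ(G)` of [AbsTopIII], Remark 3.2.1, we
obtain another cyclotomic rigidity isomorphism `(l·Δ_Θ)_S ⊗ (ℤ/Nℤ) ≅ μ_N(S)` `(*bs-Gal)`." DATA: the
three [AbsTopIII] cyclotomes mod `N` with the two natural isomorphisms and the two correspondences;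
`(*bs-Gal)` is then DEFINED as the printed composite. TODO-merge:abc-iut-L4-t1 ([AbsTopIII] §1 Cor.
1.10), abc-iut-L4-t2 ([AbsTopIII] §3 Def. 3.1, Rmk. 3.2.1). [claim: Mochizuki2012, status: disputed] (IUTchII §1 Prop 1.3 (ii), kurims p.26) -/
structure BsGalData {F : TemperedFrobenioidData S} {E : EnvOfFrobenioid F}
    (Z : FrobenioidCyclotomes E) : Type (u + 1) where
  /-- `μ_Ẑ(M_TM) ⊗ ℤ/Nℤ`, `μ_Ẑ(G) ⊗ ℤ/Nℤ` (`= μ_Ẑ(G_k)`), `μ_Ẑ(Π_X) ⊗ ℤ/Nℤ` as abstract groups -/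
  muMTM : Type u
  muG : Type u
  muPiX : Type u
  [grpMTM : Group muMTM]
  [grpG : Group muG]
  [grpPiX : Group muPiX]
  /-- [AbsTopIII] Cor. 1.10 (c): the natural isomorphism `μ_Ẑ(G_k) ≅ μ_Ẑ(Π_X)` (mod `N`) -/
  corGk_PiX : muG ≃* muPiX
  /-- [AbsTopIII] Rmk. 3.2.1: the natural isomorphism `μ_Ẑ(M_TM) ≅ μ_Ẑ(G)` (mod `N`) -/
  corMTM_G : muMTM ≃* muG
  /-- "`μ_N(S)` corresponds to `μ_Ẑ(M_TM) ⊗ ℤ/Nℤ`" -/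
  corr_muN : Z.muN ≃* muMTM
  /-- "`(l·Δ_Θ)_S ⊗ ℤ/Nℤ` corresponds to `μ_Ẑ(Π_X) ⊗ ℤ/Nℤ`" -/
  corr_intS : Z.intS.carrier ≃* muPiX

attribute [instance] BsGalData.grpMTM BsGalData.grpG BsGalData.grpPiX

/-- **IUTchII:Prop1.3(ii)**, the isomorphism `(*bs-Gal) : (l·Δ_Θ)_S ⊗ (ℤ/Nℤ) ≅ μ_N(S)`, DEFINED as printed:
`(l·Δ_Θ)_S ⊗ ℤ/Nℤ → μ_Ẑ(Π_X) → μ_Ẑ(G_k) → μ_Ẑ(M_TM) → μ_N(S)` (inverses of the two natural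
isomorphisms composed with the correspondences). [claim: Mochizuki2012, status: disputed] (IUTchII §1 Prop 1.3 (ii), kurims p.26) -/
def BsGalData.bsGal {F : TemperedFrobenioidData S} {E : EnvOfFrobenioid F} {Z : FrobenioidCyclotomes E}
    (B : BsGalData Z) : Z.intS.carrier ≃* Z.muN :=
  B.corr_intS.trans (B.corGk_PiX.symm.trans (B.corMTM_G.symm.trans B.corr_muN.symm))

/-- **IUTchII:Prop1.3(i)**: in the situation of Prop. 1.2 (ii), the Frobenioid-theoretic
cyclotome data and the [AbsTopIII] comparison data exist (functorially). PREDICATE on the Prop. 1.2 (ii)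
output `E`. [claim: Mochizuki2012, status: disputed] (IUTchII §1 Prop 1.3 (i)(ii), kurims p.26) -/
def Prop13_i_ii {F : TemperedFrobenioidData S} (E : EnvOfFrobenioid F) : Prop :=
  ∃ Z : FrobenioidCyclotomes E, Nonempty (BsGalData Z)

/-- **IUTchII:Prop1.3(iii)** (p. 26) "(Compatibility)": "The cyclotomic rigidity isomorphisms `(*mono-Θ)`,
`(*bs-Gal)` of [EtTh], [AbsTopIII] [cf. (i), (ii)] coincide." (Printed proof, p. 27: both "coincide
with the conventional identification between the cyclotomes involved that arises from conventional
scheme theory".) PREDICATE (the printed equation) on the data `(C, Z, B)`.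
[claim: Mochizuki2012, status: disputed] (IUTchII §1 Prop 1.3 (iii), kurims pp.26-27) -/
def Prop13_iii {F : TemperedFrobenioidData S} {E : EnvOfFrobenioid F} (C : CyclotomicRigidity E.recon)
    (Z : FrobenioidCyclotomes E) (B : BsGalData Z) : Prop :=
  Z.monoTheta C = B.bsGal

/-! ## Proposition 1.4: étale theta functions of standard type -/

/-- INTERFACE: a **directed system of first cohomology modules** `J ↦ H¹(J', A)` indexed by the finite-index
open subgroups `J` of a topological group `P` (`J' = H ∩ J` for a fixed open subgroup `H`, "the fibre
product `×_Π J`"), with its direct limit `lim_J H¹(…)` and the canonical maps. Continuous cohomology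
of tempered groups is not in the tree; the modules are carried abstractly (additively written).
TODO-merge:abc-iut-L2-t1 ([EtTh] §1 `H¹(Π^tp_Ÿ, Δ_Θ)`). [claim: Mochizuki2012, status: disputed] (IUTchII §1 Prop 1.4, kurims p.27) -/
structure CohomologySystem (P : TopGroup.{u}) : Type (u + 1) where
  /-- `H¹(H|_J, A)` for `J` an open subgroup of finite index (and `H¹(H, A)` at `J = ⊤`) -/
  H1 : Subgroup P → Type u
  [grp : ∀ J, AddCommGroup (H1 J)]
  /-- restriction maps along `J' ≤ J` -/
  res : ∀ {J J' : Subgroup P}, J' ≤ J → (H1 J →+ H1 J')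
  /-- the direct limit `lim_J H¹(H|_J, A)` over finite-index open `J` -/
  lim : Type u
  [grpLim : AddCommGroup lim]
  /-- the canonical maps to the limit -/
  toLim : ∀ J : Subgroup P, H1 J →+ lim
  toLim_res : ∀ {J J' : Subgroup P} (h : J' ≤ J) (x : H1 J), toLim J' (res h x) = toLim J x

attribute [instance] CohomologySystem.grp CohomologySystem.grpLim

/-- **IUTchII:Prop1.4** (p. 27), OUTPUT of the algorithms `Π ↦ Π_Ÿ(Π); (l·Δ_Θ)(Π); θ(Π)` for `Π ≅ Π^tp_{X̲̲_k}`: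
"the open subgroup `Π_Ÿ(Π) ⊆ Π` corresponding to the tempered covering `Ÿ` [cf. the discussion
preceding [EtTh], Definition 2.7] and a certain subquotient `(l·Δ_Θ)(Π)` of `Π` [cf. the subquotient
`(l·Δ_Θ)(M^Θ)` of Definition 1.1, (i)], as well as … the set `θ(Π) ⊆ H¹(Π_Ÿ(Π), (l·Δ_Θ)(Π))` of
`μ_l`-multiples … of the reciprocal of the `(l·ℤ × μ_2)`-orbit `η̈^{Θ,l·ℤ×μ_2}` of an `l`-th root of the
étale theta function of standard type of [EtTh], Definition 2.7 [constant multiple rigidity, [EtTh]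
Cor. 2.19 (iii)]." The cohomology `H¹(Π_Ÿ(Π)|_J, (l·Δ_Θ)(Π))` is the interface `CohomologySystem`;
"corresponding to `Ÿ`" is typed [EtTh] Cor. 2.18 (i)-style: every isomorphism `Π ≅ Π^tp_{X̲̲_k}`
carries `Π_Ÿ(Π)` to the reference subgroup `PiYddRef` supplied with the data; the orbit `η̈^{Θ,l·ℤ×μ_2}` is an
interface field and `θ(Π)` is DEFINED from it (`theta_eq`).
[claim: Mochizuki2012, status: disputed] (IUTchII §1 Prop 1.4, kurims p.27) -/
structure EtaleThetaData (S : ThetaSetting.{u}) (P : TopGroup.{u}) : Type (u + 1) where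
  isoRef : Nonempty (P ≃ₜ* S.PiX)
  /-- the reference open subgroup `Π^tp_{Ÿ̲_k} ⊆ Π^tp_{X̲̲_k}` (interface datum, [EtTh] §2) -/
  PiYddRef : Subgroup S.PiX
  /-- `Π_Ÿ(Π) ⊆ Π`, open -/
  PiYdd : Subgroup P
  isOpen_PiYdd : IsOpen (PiYdd : Set P)
  /-- "corresponding to the tempered covering `Ÿ`": transported to the reference by every isomorphism -/
  PiYdd_corresponds : ∀ e : P ≃ₜ* S.PiX, PiYdd.map e.toMulEquiv.toMonoidHom = PiYddRef
  /-- `(l·Δ_Θ)(Π)`, a subquotient of `Π` -/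
  lDeltaTheta : Subquotient P
  /-- `J ↦ H¹(Π_Ÿ(Π)|_J, (l·Δ_Θ)(Π))` with its direct limit (interface) -/
  coh : CohomologySystem P
  /-- the `(l·ℤ × μ_2)`-orbit `η̈^{Θ,l·ℤ×μ_2}` of [the Kummer class of] an `l`-th root of the étale theta
  function of standard type ([EtTh] Def. 2.7; interface datum — its members differ by NON-torsion classes:
  `η̈ ↦ η̈⁻¹` under `μ_2`, deck translates under `l·ℤ`) -/
  orbit : Set (coh.H1 ⊤)
  orbit_nonempty : orbit.Nonempty
  /-- `θ(Π) ⊆ H¹(Π_Ÿ(Π), (l·Δ_Θ)(Π))` -/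
  theta : Set (coh.H1 ⊤)
  /-- "the set `θ(Π)` of `μ_l`-multiples of the RECIPROCAL of the orbit": additively, `b ∈ θ(Π)` iff
  `b = z - o` for some `o` in the orbit and some `z` with `l·z = 0`, i.e. iff `l·(b + o) = 0` for some `o ∈ orbit`
  (a UNION of `l`-torsion cosets, one per orbit member — review of p405599) -/
  theta_eq : theta = {b | ∃ o ∈ orbit, (S.l : ℕ) • (b + o) = 0}

/-- PROVED from `theta_eq`: the reciprocal (additively, the negative) of every orbit member lies in `θ(Π)`
(the `μ_l`-multiple with trivial multiplier); in particular `θ(Π)` is nonempty.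
[claim: Mochizuki2012, status: disputed] (IUTchII §1 Prop 1.4, kurims p.27) -/
theorem EtaleThetaData.neg_mem_theta {P : TopGroup.{u}} (D : EtaleThetaData S P) {o : D.coh.H1 ⊤}
    (ho : o ∈ D.orbit) : -o ∈ D.theta := by
  rw [D.theta_eq]
  exact ⟨o, ho, by simp⟩

/-- PROVED: `θ(Π)` is nonempty. [claim: Mochizuki2012, status: disputed] (IUTchII §1 Prop 1.4, kurims p.27) -/
theorem EtaleThetaData.theta_nonempty {P : TopGroup.{u}} (D : EtaleThetaData S P) : D.theta.Nonempty := by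
  obtain ⟨o, ho⟩ := D.orbit_nonempty
  exact ⟨-o, D.neg_mem_theta ho⟩

/-- **IUTchII:Prop1.4**, the DEFINITION of `∞θ(Π)` (p. 27): "`∞θ(Π) ⊆ lim_J H¹(Π_Ÿ(Π)|_J, (l·Δ_Θ)(Π))`
denotes the subset of elements of the direct limit of cohomology modules … for which some [positive
integer] multiple coincides, up to torsion, with an element of `θ(Π)`; `J` ranges over the finite
index open subgroups of `Π`." [claim: Mochizuki2012, status: disputed] (IUTchII §1 Prop 1.4, kurims p.27) -/
def EtaleThetaData.thetaInfty {P : TopGroup.{u}} (D : EtaleThetaData S P) : Set D.coh.lim :=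
  {x | ∃ (n : ℕ), 0 < n ∧ ∃ t ∈ D.theta, IsOfFinAddOrder (n • x - D.coh.toLim ⊤ t)}

/-! **Existence clause** of Prop. 1.4 ("there exists a functorial group-theoretic algorithm …"): NOT typed as a named
fact (reviews of `MonoThetaCyclotomes`: over an axiom-free interface the transport form is trivially provable and
the unguarded form is false for junk settings). The existence content is the owners' construction of the output
below for the genuine reference group ([EtTh] Cor. 2.18 (i), 2.19 (iii), abc-iut-L2-t1/t2/t4); functoriality = transport of the output structure along `≃ₜ*`. -/

end Literature.IUT.HodgeArakelov
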